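import Mathlib.Analysis.Calculus.Deriv.Slope
import Mathlib.Analysis.Complex.CauchyIntegral
import Literature.Analysis.Complex.SchwarzReflection
import HarnessLib

/-!
# Pick engine helper (line `pick-half-plane`, stub `stub_pickEngine`): nonzero values at flat points

Support file for crux `BoundaryClosureR` (stmt-CriticalPhenomena-14004), line `pick-half-plane`,
stub `stub_pickEngine`, STAGE 2, clause 3 of `IsPickCupLimit` (`∃ w ≠ 0, g → w` at every flat
boundary point `y ≠ x` of the gate and of the root's own flat piece).  In the limit the normalised
developing map `h` is holomorphic on the upper half-disc `U = {im z > im y} ∩ B(y, ρ)`, continuous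
up to the diameter, and maps the diameter into a LINE `p + e^{iθ}ℝ` (the gate: `re h = const`,
`θ = π/2`; the root's floor: the arm line).  Then `h` reflects across the diameter (Conway IX.1.1,
in the tree as `Complex.differentiableOn_schwarzReflection`, applied to `e^{-iθ}(h - p)`), so
`h'` has a limit `w` at `y` from inside `U`; and `w ≠ 0` as soon as the NORMAL component of
`h - p` grows at least linearly off the diameter, `c·t ≤ |im (e^{-iθ}(h(y + it) - p))|` — the
continuum form of a UNIFORM-IN-SCALE lower bound on the arrival-mass density at `y` (the flux of
`re h` through the gate).  The lattice input this consumes is therefore a density law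
`C⁻¹ ρ' Z(b_δ) ≤ δ Σ_{δ·mid e' ∈ B(y, ρ')} Z(e')` with `C` independent of `ρ'`; the line's
`GateMassLaws` (a) lets `C` depend on `ρ'` and covers the gate only (reported by the worker).

* `pickEngine_flatValue` — the statement above (registered sub-goal of `stub_pickEngine`).

References: Conway, *Functions of One Complex Variable I* (1978), IX.1.1; Pommerenke,
*Boundary Behaviour of Conformal Maps* (1992), §3.1.
-/

noncomputable section

open scoped Topology ComplexConjugate
open Filter Set Metric Complex

namespace Summit.CriticalPhenomena.SAWScalingLimit.Theorems.PickHalfPlane.Engine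

/-- **Nonzero boundary values of `h'` at a flat point (registered sub-goal `pickEngine_flatValue`
of stub `stub_pickEngine`).** Let `h` be holomorphic on the upper half-disc
`{im z > im y} ∩ B(y, ρ)`, continuous on the closed upper half-disc, mapping the diameter into the
line `p + e^{iθ}ℝ`, with normal growth `c·t ≤ |im (e^{-iθ}(h(y + it) - p))|` for `0 < t < ρ`
(`c > 0`). Then `h'` converges, as `z → y` inside the half-disc, to some `w ≠ 0`: by Schwarz
reflection `e^{-iθ}(h - p)` extends holomorphically across the diameter, `w = e^{iθ} R'(0)` for the
reflected function `R`, and `|re R'(0)| ≥ c` from the difference quotients along the normal.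
[folklore] -/
theorem pickEngine_flatValue :
    ∀ (y p : ℂ) (θ ρ c : ℝ) (h : ℂ → ℂ), 0 < ρ → 0 < c →
      DifferentiableOn ℂ h ({z : ℂ | y.im < z.im} ∩ Metric.ball y ρ) →
      ContinuousOn h ({z : ℂ | y.im ≤ z.im} ∩ Metric.ball y ρ) →
      (∀ z ∈ Metric.ball y ρ, z.im = y.im →
        (Complex.exp (-((θ : ℂ) * Complex.I)) * (h z - p)).im = 0) →
      (∀ t : ℝ, 0 < t → t < ρ →
        c * t ≤ |(Complex.exp (-((θ : ℂ) * Complex.I)) * (h (y + (t : ℂ) * Complex.I) - p)).im|) →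
      ∃ w : ℂ, w ≠ 0 ∧
        Filter.Tendsto (deriv h) (𝓝[{z : ℂ | y.im < z.im} ∩ Metric.ball y ρ] y) (𝓝 w) := by
  intro y p θ ρ c h hρ hc hdiff hcont hline hgrowth
  -- the translated and rotated function, and its reflection
  set F : ℂ → ℂ := fun w => exp (-((θ : ℂ) * I)) * (h (w + y) - p) with hF
  set U₀ : Set ℂ := ball (0 : ℂ) ρ with hU₀
  have hU₀symm : ∀ w ∈ U₀, conj w ∈ U₀ := fun w hw => by
    simpa [hU₀, mem_ball, dist_eq_norm] using hw
  have hshift : ∀ {w : ℂ}, w ∈ U₀ → w + y ∈ ball y ρ := fun {w} hw => by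
    simpa [hU₀, mem_ball, dist_eq_norm] using hw
  have hFc : ContinuousOn F (U₀ ∩ {w | 0 ≤ w.im}) := by
    have h1 : ContinuousOn (fun w => h (w + y)) (U₀ ∩ {w | 0 ≤ w.im}) := by
      refine hcont.comp (continuous_id.add continuous_const).continuousOn ?_
      rintro w ⟨hw, hwim⟩
      exact ⟨by show y.im ≤ (w + y).im; simpa using hwim, hshift hw⟩
    exact continuousOn_const.mul (h1.sub continuousOn_const)
  have hUopen : IsOpen ({z : ℂ | y.im < z.im} ∩ ball y ρ) :=
    (isOpen_lt continuous_const continuous_im).inter isOpen_ball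
  have hFd : DifferentiableOn ℂ F (U₀ ∩ {w | 0 < w.im}) := by
    rintro w ⟨hw, hwim⟩
    have hwim' : 0 < w.im := hwim
    have hmem : w + y ∈ {z : ℂ | y.im < z.im} ∩ ball y ρ :=
      ⟨by show y.im < (w + y).im; simpa using hwim', hshift hw⟩
    have hd : DifferentiableAt ℂ h (w + y) := (hdiff _ hmem).differentiableAt (hUopen.mem_nhds hmem)
    have h1 : DifferentiableAt ℂ (fun w => h (w + y)) w :=
      hd.comp w (differentiableAt_id.add (differentiableAt_const y))
    exact ((differentiableAt_const _).mul (h1.sub (differentiableAt_const _))).differentiableWithinAt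
  have hFreal : ∀ w ∈ U₀, w.im = 0 → conj (F w) = F w := by
    intro w hw hwim
    have := hline (w + y) (hshift hw) (by simp [hwim])
    exact Complex.conj_eq_iff_im.2 this
  set R : ℂ → ℂ := schwarzReflection F with hR
  have hRd : DifferentiableOn ℂ R U₀ :=
    Complex.differentiableOn_schwarzReflection isOpen_ball hU₀symm hFc hFd hFreal
  have hRa : AnalyticAt ℂ R 0 := hRd.analyticAt (ball_mem_nhds 0 hρ)
  -- `deriv h = e^{iθ} R'(· - y)` on the open upper half-disc
  have hderiv : ∀ z ∈ {z : ℂ | y.im < z.im} ∩ ball y ρ,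
      deriv h z = exp ((θ : ℂ) * I) * deriv R (z - y) := by
    rintro z ⟨hzim, hz⟩
    have heq : h =ᶠ[𝓝 z] fun z => p + exp ((θ : ℂ) * I) * R (z - y) := by
      filter_upwards [hUopen.mem_nhds ⟨hzim, hz⟩] with z' hz'
      have hz'im : 0 ≤ (z' - y).im := by
        simp only [sub_im, sub_nonneg]; exact le_of_lt hz'.1
      show h z' = p + exp ((θ : ℂ) * I) * schwarzReflection F (z' - y)
      rw [schwarzReflection_of_nonneg hz'im]
      simp only [hF, sub_add_cancel]
      rw [← mul_assoc, ← Complex.exp_add, show (θ : ℂ) * I + -((θ : ℂ) * I) = 0 by ring,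
        Complex.exp_zero, one_mul, add_sub_cancel]
    rw [heq.deriv_eq]
    have hzy : z - y ∈ U₀ := by simpa [hU₀, mem_ball, dist_eq_norm] using hz
    have hRat : DifferentiableAt ℂ R (z - y) := hRd.differentiableAt (isOpen_ball.mem_nhds hzy)
    have hcomp : HasDerivAt (fun z => R (z - y)) (deriv R (z - y) * 1) z := by
      have := hRat.hasDerivAt.comp z ((hasDerivAt_id z).sub_const y)
      simpa [Function.comp_def] using this
    have hfull : HasDerivAt (fun z => p + exp ((θ : ℂ) * I) * R (z - y))
        (0 + exp ((θ : ℂ) * I) * (deriv R (z - y) * 1)) z :=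
      (hasDerivAt_const z p).add (hcomp.const_mul _)
    rw [hfull.deriv]; ring
  -- the limit `w = e^{iθ} R'(0)`
  refine ⟨exp ((θ : ℂ) * I) * deriv R 0, ?_, ?_⟩
  swap
  · have hcontR : ContinuousAt (deriv R) 0 := hRa.deriv.continuousAt
    have h1 : Tendsto (fun z => deriv R (z - y)) (𝓝 y) (𝓝 (deriv R 0)) := by
      have : Tendsto (fun z : ℂ => z - y) (𝓝 y) (𝓝 0) := by
        simpa using (tendsto_id.sub tendsto_const_nhds : Tendsto (fun z : ℂ => z - y) (𝓝 y) _)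
      exact hcontR.tendsto.comp this
    refine ((tendsto_const_nhds.mul h1).mono_left nhdsWithin_le_nhds).congr' ?_
    filter_upwards [self_mem_nhdsWithin] with z hz
    exact (hderiv z hz).symm
  -- nonvanishing: `|re R'(0)| ≥ c` from the difference quotients along the normal
  · refine mul_ne_zero (Complex.exp_ne_zero _) ?_
    have hR0 : HasDerivAt R (deriv R 0) 0 := (hRa.differentiableAt).hasDerivAt
    have hslope := hasDerivAt_iff_tendsto_slope_zero.1 hR0
    have hpath : Tendsto (fun t : ℝ => (t : ℂ) * I) (𝓝[>] 0) (𝓝[≠] 0) := by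
      refine tendsto_nhdsWithin_iff.2 ⟨?_, ?_⟩
      · have : Tendsto (fun t : ℝ => (t : ℂ) * I) (𝓝 0) (𝓝 (((0 : ℝ) : ℂ) * I)) :=
          (Complex.continuous_ofReal.tendsto 0).mul tendsto_const_nhds
        simpa using this.mono_left nhdsWithin_le_nhds
      · filter_upwards [self_mem_nhdsWithin] with t ht
        simpa using ne_of_gt ht
    have hlim : Tendsto (fun t : ℝ => |((((t : ℂ) * I)⁻¹ • (R (0 + (t : ℂ) * I) - R 0))).re|)
        (𝓝[>] 0) (𝓝 |(deriv R 0).re|) :=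
      ((continuous_abs.comp Complex.continuous_re).tendsto _).comp (hslope.comp hpath)
    have hbig : ∀ᶠ t : ℝ in 𝓝[>] 0,
        c ≤ |((((t : ℂ) * I)⁻¹ • (R (0 + (t : ℂ) * I) - R 0))).re| := by
      filter_upwards [Ioo_mem_nhdsGT hρ] with t ht
      have ht0 : (0 : ℝ) < t := ht.1
      have hRt : R (0 + (t : ℂ) * I) = F ((t : ℂ) * I) := by
        rw [zero_add]; exact schwarzReflection_of_nonneg (by simp [ht0.le])
      have hR00 : R 0 = F 0 := schwarzReflection_of_nonneg (by simp)
      have hF0 : (F 0).im = 0 := by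
        have := hline (0 + y) (hshift (mem_ball_self hρ)) (by simp)
        simpa [hF] using this
      have hquot : ((((t : ℂ) * I)⁻¹ • (R (0 + (t : ℂ) * I) - R 0))).re =
          (F ((t : ℂ) * I)).im / t := by
        rw [hRt, hR00, smul_eq_mul]
        have : ((t : ℂ) * I)⁻¹ = -I / t := by
          field_simp
          rw [Complex.I_sq]
          ring
        rw [this]
        simp [Complex.mul_re, Complex.div_re, Complex.div_im, hF0]
        field_simp
      rw [hquot, abs_div, abs_of_pos ht0, le_div_iff₀ ht0]
      have := hgrowth t ht0 ht.2
      simpa [hF, add_comm] using this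
    have hge : c ≤ |(deriv R 0).re| := ge_of_tendsto hlim hbig
    intro h0
    rw [h0, Complex.zero_re, abs_zero] at hge
    linarith

end Summit.CriticalPhenomena.SAWScalingLimit.Theorems.PickHalfPlane.Engine

end
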